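import Mathlib
import HarnessLib
import Summits.QuantumFields.YangMills.Theorems.PencilRigidityCurvatureKernelBoundFiniteCouplingStrongSubexp
import Summits.QuantumFields.YangMills.Theorems.PencilRigidityCurvatureKernelBoundStrongCouplingClusteringDiscExplicit
import Summits.QuantumFields.YangMills.Theorems.PencilRigidityCurvatureKernelBoundStrongCouplingTruncatedVanishingAt
import Summits.QuantumFields.YangMills.Theorems.PencilRigidityCurvatureKernelBoundTemperedSubsequence
import Summits.QuantumFields.YangMills.Theorems.PencilRigidityCurvatureKernelBoundTruncatedAxialPropagation

/-!
# `CurvatureKernelBound` — child 2a `FiniteCouplingStrongTempered`: the strong-coupling disc with TEMPERED renormalisation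
# (stub for stmt-QuantumFields-11687, line `coupling-trichotomy`, skeleton v7, lead c9)

Crux `stmt-QuantumFields-11687` (`PencilRigidity.CurvatureKernelBound`). Child 2 (`β_k → b ∈ ℝ`) of the strategist's
split is rebuilt in skeleton v7 from three stubs; this file PROVES the first, `Stub.FiniteCouplingStrongTempered`: every
`W₁`-datum `(r, sch, S₁)` whose couplings converge INTO the strong-coupling disc (`β_k → b`, `|b| < betaOne 4 r.ρ / 2`, the
radius of the tree's replica expansion) and whose plaquette renormalisation is TEMPERED — `∃ δ₀, ∃ᶠ k, c_k² e^{−δ₀/a_k} ≤ 1`,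
i.e. `liminf a_k log c_k² < ∞`; every sub-exponential and every polynomial `c_k` (lead c8's `FiniteCouplingStrongSubexp`,
p138516, is the special case `δ₀` arbitrary) — satisfies the conclusion of the crux, UNCONDITIONALLY.

Proof. (1) `TemperedSubsequence` (p140256) + `exists_subseqScheme_full`: pass to a subsequence scheme `sch'` along which
`c² e^{−δ/a} → 0` for every `δ > δ₀`; `W₁` survives (the lattice `n`-point functions re-index definitionally, the gap clause
is eventual). (2) `StrongCouplingClusteringDiscExplicit` (p140230) gives one mass `m` and one constant for the curvature on the
closed disc `|β| ≤ β' := (|b| + betaOne/2)/2`, and `StrongCouplingTruncatedVanishingAt` (p140236) kills the truncated smeared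
lattice two-point function in the limit on the axial balls `B̄(∓s e₀, ρ)`, `ρ ≤ s/2`, for every separation with `m s > δ₀`;
the lattice tie of `W₁` at `n = 2, 1` turns this into `S₁ 2 (f₀ ⊗ f₁) = S₁ 1 f₀ · S₁ 1 f₁` for FAR pairs (`s > δ₀/m`).
(3) `TruncatedAxialPropagation` (p140391): reflection positivity + translation invariance + `𝔖₀ = 1` of the LIMIT propagate the
factorisation to ALL `s > 0` (`⟪χ, e^{−t₀H}χ⟫ = 0 ⇒ e^{−tH}χ = 0 ∀ t > 0`). (4) Hence the two-point local decay with
`η = 10`, `A = ‖κ‖²` (`S₁ 1 = κ∫`), `B = 0`, and `KernelConclusionOfWitnessLocalDecay` (p131920) yields the real kernel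
continuous off `0` with `|K x| ≤ C (1 + ‖x‖^(η−10))` representing `S₁ 2` on `⁰𝒮`. What stays OPEN inside child 2 after this
file: the disc with HYPER-exponential `c_k` (`a_k log c_k² → +∞`; needs a lower bound on the plaquette–plaquette covariance)
and the intermediate couplings `betaOne/2 ≤ |b|` — skeleton stubs `FiniteCouplingStrongHyper`, `FiniteCouplingIntermediate`.
[OsterwalderSeiler1978 Thm. 3.5; OsterwalderSchrader1973 §4.1; folklore]
-/

noncomputable section

open scoped BigOperators Topology SchwartzMap
open MeasureTheory Filter Set Metric
open Literature.MathematicalPhysics.QuantumLattice Literature.MathematicalPhysics.AQFT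
  Literature.MathematicalPhysics.QuantumFieldTheory

namespace Summit.QuantumFields.YangMills.Theorems.CurvatureKernel

/-- **Sub-schemes with all data exposed**: along a strictly increasing `φ` there is a scheme whose lattice `n`-point
functions of the curvature are the re-indexed ones (definitionally), whose couplings, spacings and renormalisations are the
re-indexed ones, and which keeps every uniform lattice mass gap (cf. `exists_subseqScheme`). [folklore] -/
theorem exists_subseqScheme_full {G : Type} [Group G] [TopologicalSpace G] [IsTopologicalGroup G]
    [CompactSpace G] [MeasurableSpace G] [BorelSpace G] (r : LatticeRep G)
    (sch : SpeciesScheme (YMSpecies G)) (φ : ℕ → ℕ) (hφ : StrictMono φ) :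
    ∃ sch' : SpeciesScheme (YMSpecies G),
      (∀ (k n : ℕ) (f : Fin n → 𝓢(EuclideanSpace ℝ (Fin 4), ℝ)),
          latticeSchwinger r.ρ sch' (fun s => s.F) k n (fun _ => r.curvature) f =
            latticeSchwinger r.ρ sch (fun s => s.F) (φ k) n (fun _ => r.curvature) f) ∧
        (sch'.β = fun k => sch.β (φ k)) ∧ (sch'.a = fun k => sch.a (φ k)) ∧
        (sch'.c = fun s k => sch.c s (φ k)) ∧
        ∀ Δ : ℝ, HasLatticeMassGap r sch Δ → HasLatticeMassGap r sch' Δ := by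
  refine ⟨{ a := fun k => sch.a (φ k)
            a_pos := fun k => sch.a_pos (φ k)
            tendsto_a := sch.tendsto_a.comp hφ.tendsto_atTop
            β := fun k => sch.β (φ k)
            L := fun k => sch.L (φ k)
            tendsto_L := sch.tendsto_L.comp hφ.tendsto_atTop
            c := fun s k => sch.c s (φ k)
            m := fun s k => sch.m s (φ k) }, fun _ _ _ => rfl, rfl, rfl, rfl, ?_⟩
  intro Δ h A B
  obtain ⟨C, hC⟩ := h A B
  exact ⟨C, hφ.tendsto_atTop.eventually hC⟩

/-- A Schwartz function is bounded. [folklore] -/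
theorem exists_abs_le_schwartz (f : 𝓢(EuclideanSpace ℝ (Fin 4), ℝ)) : ∃ M : ℝ, ∀ x, |f x| ≤ M := by
  obtain ⟨C, _, hC⟩ := f.decay 0 0
  refine ⟨C, fun x => ?_⟩
  have h := hC x
  rw [pow_zero, one_mul, norm_iteratedFDeriv_zero, Real.norm_eq_abs] at h
  exact h

open SemiDegenerate BoundedRenormalisation in
/-- **Stub `FiniteCouplingStrongTempered`** (child 2a of skeleton v7, registered signature verbatim): on the strong-coupling
disc `|b| < betaOne 4 r.ρ / 2`, every `W₁`-datum with TEMPERED plaquette renormalisation satisfies the conclusion of the crux.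
See the module docstring for the four steps (tempered subsequence; uniform clustering + per-separation truncated vanishing on
far axial pairs; reflection-positivity propagation to all separations; local decay with `η = 10`, `B = 0` and the kernel
conclusion). [folklore] -/
theorem FiniteCouplingStrongTempered : open Literature.MathematicalPhysics.QuantumLattice Literature.MathematicalPhysics.AQFT Literature.MathematicalPhysics.QuantumFieldTheory in ∀ (G : Type) [Group G] [TopologicalSpace G] [IsTopologicalGroup G] [CompactSpace G] [MeasurableSpace G] [BorelSpace G], IsCompactSimpleLieGroup G → ∀ (r : LatticeRep G) (sch : SpeciesScheme (YMSpecies G)) (S₁ : SchwingerFamily (EuclideanSpace ℝ (Fin 4))), ((∀ (n : ℕ), n ≠ 0 → ∀ (f : Fin n → SchwartzMap ((EuclideanSpace ℝ (Fin 4))) ℝ) (F : SchwartzMap (Fin n → (EuclideanSpace ℝ (Fin 4))) ℂ), IsTensorOf F (fun i => ofRealTest (f i)) → IsOffDiagonal F → Filter.Tendsto (fun k : ℕ => ((latticeSchwinger r.ρ sch (fun s => s.F) k n (fun _ => r.curvature) f : ℝ) : ℂ)) Filter.atTop (nhds (S₁ n F))) ∧ (S₁.toLabelled.IsNormalized ∧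 S₁.toLabelled.IsHermitian ∧ S₁.toLabelled.HasLinearGrowth ∧ S₁.toLabelled.IsReflectionPositive ∧ S₁.toLabelled.IsSymmetric ∧ S₁.toLabelled.HasClusterProperty) ∧ (∀ (n : ℕ) (a : (EuclideanSpace ℝ (Fin 4))) (F : SchwartzMap (Fin n → (EuclideanSpace ℝ (Fin 4))) ℂ), IsOffDiagonal F → S₁ n (translateMulti a F) = S₁ n F) ∧ (∀ (R : (EuclideanSpace ℝ (Fin 4)) ≃ₗᵢ[ℝ] (EuclideanSpace ℝ (Fin 4))), LinearMap.det (R.toLinearEquiv : (EuclideanSpace ℝ (Fin 4)) →ₗ[ℝ] (EuclideanSpace ℝ (Fin 4))) = 1 → (∀ i : Fin 4, ∃ j : Fin 4, R (EuclideanSpace.single i 1) = EuclideanSpace.single j 1 ∨ R (EuclideanSpace.single i 1) = -EuclideanSpace.single j 1) → ∀ (n : ℕ) (F : SchwartzMap (Fin n → (EuclideanSpace ℝ (Fin 4))) ℂ), IsOffDiagonal F → S₁ n (linActMulti R F) = S₁ n F) ∧ (∃ Δ : ℝ, 0 < Δ ∧ S₁.toLabelled.HasMassGap Δ ∧ HasLatticeMassGap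 r sch Δ)) → (∃ b : ℝ, Filter.Tendsto sch.β Filter.atTop (nhds b) ∧ |b| < betaOne 4 r.ρ / 2) → (∃ δ₀ : ℝ, ∃ᶠ k in Filter.atTop, sch.c r.curvature k ^ 2 * Real.exp (-(δ₀ / sch.a k)) ≤ 1) → ∃ (K : (EuclideanSpace ℝ (Fin 4)) → ℝ) (C η : ℝ), 0 < η ∧ ContinuousOn K {x : (EuclideanSpace ℝ (Fin 4)) | x ≠ 0} ∧ (∀ x : (EuclideanSpace ℝ (Fin 4)), x ≠ 0 → |K x| ≤ C * (1 + ‖x‖ ^ (η - 10))) ∧ ∀ F : SchwartzMap (Fin 2 → (EuclideanSpace ℝ (Fin 4))) ℂ, IsOffDiagonal F → MeasureTheory.Integrable (fun x : Fin 2 → (EuclideanSpace ℝ (Fin 4)) => (K (x 0 - x 1) : ℂ) * F x) ∧ S₁ 2 F = ∫ x : Fin 2 → (EuclideanSpace ℝ (Fin 4)), (K (x 0 - x 1) : ℂ) * F x := by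
  intro G _ _ _ _ _ _ hG r sch S₁ hW₁ hb hc
  obtain ⟨b, hb, hbβ⟩ := hb
  obtain ⟨δ₀, hδ₀⟩ := hc
  haveI : T2Space G := (r.continuous.isClosedEmbedding r.injective).isEmbedding.t2Space
  haveI : SecondCountableTopology G :=
    (r.continuous.isClosedEmbedding r.injective).isEmbedding.secondCountableTopology
  -- (1) a tempered subsequence scheme
  obtain ⟨φ, hφ, hcφ⟩ := TemperedSubsequence sch.a (sch.c r.curvature) sch.a_pos sch.tendsto_a δ₀ hδ₀
  obtain ⟨sch', hls, hβ', ha', hc', hgap'⟩ := exists_subseqScheme_full r sch φ hφ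
  obtain ⟨hconv, hpkg, htr, hhyp, Δ, hΔ, hgap, hlat⟩ := id hW₁
  have hconv' : ∀ (n : ℕ), n ≠ 0 → ∀ (f : Fin n → 𝓢(EuclideanSpace ℝ (Fin 4), ℝ))
      (F : 𝓢((Fin n → EuclideanSpace ℝ (Fin 4)), ℂ)), IsTensorOf F (fun i => ofRealTest (f i)) → IsOffDiagonal F →
      Tendsto (fun k : ℕ => ((latticeSchwinger r.ρ sch' (fun s => s.F) k n (fun _ => r.curvature) f : ℝ) : ℂ))
        atTop (𝓝 (S₁ n F)) := by
    intro n hn f F hF hoff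
    refine ((hconv n hn f F hF hoff).comp hφ.tendsto_atTop).congr (fun k => ?_)
    simp only [Function.comp_apply, hls]
  -- (2) the closed disc `|β| ≤ β'`, `|b| < β' < betaOne/2`, eventually containing the couplings of `sch'`
  set β₀ : ℝ := betaOne 4 r.ρ / 2 with hβ₀def
  set β' : ℝ := (|b| + β₀) / 2 with hβ'def
  have hb0 : 0 ≤ |b| := abs_nonneg b
  have hβ'0 : 0 < β' := by rw [hβ'def]; linarith
  have hβ'1 : β' < betaOne 4 r.ρ / 2 := by rw [hβ'def]; linarith
  have hbβ' : |b| < β' := by rw [hβ'def]; linarith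
  obtain ⟨m, hm, hAm⟩ := StrongCouplingClusteringDiscExplicit 4 r.N G r.ρ (by norm_num) r.continuous β' hβ'0 hβ'1
  obtain ⟨C, hC⟩ := hAm r.curvature.F r.curvature.F ⟨_, r.curvature.isCylinder⟩ ⟨_, r.curvature.isCylinder⟩
    r.curvature.measurable r.curvature.measurable r.curvature.bounded r.curvature.bounded
  have hev : ∀ᶠ k in atTop, |sch'.β k| ≤ β' := by
    have h1 : Tendsto sch'.β atTop (𝓝 b) := by rw [hβ']; exact hb.comp hφ.tendsto_atTop
    exact ((continuous_abs.tendsto b).comp h1).eventually (Iic_mem_nhds hbβ')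
  -- the far factorisation: `S₁ 2 (f 0 ⊗ f 1) = S₁ 1 (f 0) · S₁ 1 (f 1)` on axial balls with separation `s > δ₀ / m`
  have hfar : ∀ (s ρ : ℝ), δ₀ / m < s → 0 < ρ → ρ ≤ s / 2 →
      ∀ (f : Fin 2 → 𝓢(EuclideanSpace ℝ (Fin 4), ℝ)) (F : 𝓢((Fin 2 → EuclideanSpace ℝ (Fin 4)), ℂ))
        (F₀ F₁ : 𝓢((Fin 1 → EuclideanSpace ℝ (Fin 4)), ℂ)), IsTensorOf F (fun i => ofRealTest (f i)) →
        IsTensorOf F₀ (fun _ => ofRealTest (f 0)) → IsTensorOf F₁ (fun _ => ofRealTest (f 1)) →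
        tsupport ((f 0 : 𝓢(EuclideanSpace ℝ (Fin 4), ℝ)) : EuclideanSpace ℝ (Fin 4) → ℝ) ⊆
          closedBall (EuclideanSpace.single (0 : Fin 4) (-s)) ρ →
        tsupport ((f 1 : 𝓢(EuclideanSpace ℝ (Fin 4), ℝ)) : EuclideanSpace ℝ (Fin 4) → ℝ) ⊆
          closedBall (EuclideanSpace.single (0 : Fin 4) s) ρ →
        S₁ 2 F = S₁ 1 F₀ * S₁ 1 F₁ := by
    intro s ρ hs hρ hρs f F F₀ F₁ hF hF₀ hF₁ h0 h1
    have hs0 : 0 < s := by linarith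
    have hms : δ₀ < m * s := by rwa [div_lt_iff₀' hm] at hs
    -- the one rate needed at this separation
    have hrate : Tendsto (fun k : ℕ => sch'.c r.curvature k ^ 2 * Real.exp (-(m * s / sch'.a k))) atTop (𝓝 0) := by
      have h := hcφ (m * s) hms
      rw [hc', ha']
      exact h
    obtain ⟨M₀, hM₀⟩ := exists_abs_le_schwartz (f 0)
    obtain ⟨M₁, hM₁⟩ := exists_abs_le_schwartz (f 1)
    have ht := StrongCouplingTruncatedVanishingAt G r sch' β' m C hm hC hev s ρ hs0 hρ hρs hrate f M₀ M₁ h0 h1 hM₀ hM₁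
    have hFoff : IsOffDiagonal F :=
      isOffDiagonal_of_isTensorOf_of_disjoint hF ((disjoint_closedBall_single hs0 hρs).mono h0 h1)
    have hu := hconv' 2 two_ne_zero f F hF hFoff
    have hv := hconv' 1 one_ne_zero (fun _ => f 0) F₀ hF₀ (HypercubicLimit.Negative.isOffDiagonal_fin_one F₀)
    have hw := hconv' 1 one_ne_zero (fun _ => f 1) F₁ hF₁ (HypercubicLimit.Negative.isOffDiagonal_fin_one F₁)
    have ht' : Tendsto (fun k : ℕ =>
        ((latticeSchwinger r.ρ sch' (fun s => s.F) k 2 (fun _ => r.curvature) f : ℝ) : ℂ) -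
          ((latticeSchwinger r.ρ sch' (fun s => s.F) k 1 (fun _ => r.curvature) (fun _ => f 0) : ℝ) : ℂ) *
            ((latticeSchwinger r.ρ sch' (fun s => s.F) k 1 (fun _ => r.curvature) (fun _ => f 1) : ℝ) : ℂ))
        atTop (𝓝 0) := by
      have h := (Complex.continuous_ofReal.tendsto 0).comp ht
      rw [Complex.ofReal_zero] at h
      refine h.congr fun k => ?_
      simp only [Function.comp_apply, Complex.ofReal_sub, Complex.ofReal_mul]
    have hZ : S₁ 2 F - S₁ 1 F₀ * S₁ 1 F₁ = 0 := tendsto_nhds_unique (hu.sub (hv.mul hw)) ht'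
    exact sub_eq_zero.1 hZ
  -- (3) reflection positivity propagates the factorisation to all separations
  obtain ⟨hnorm, -, -, hrp, -, -⟩ := hpkg
  have hall := TruncatedAxialPropagation S₁ hrp htr hnorm (δ₀ / m) hfar
  -- (4) two-point LOCAL DECAY with `η = 10`, `A = ‖κ‖²`, `B = 0`, and the kernel conclusion
  obtain ⟨κ, hκ⟩ := exists_degreeOne_eq_const_mul_realIntegral S₁ htr
  refine KernelConclusionOfWitnessLocalDecay G hG r sch S₁ hW₁ ⟨‖κ‖ ^ 2, 10, 1, by norm_num, one_pos, ?_⟩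
  intro s hs _
  refine ⟨s / 2, ‖κ‖ ^ 2, 0, half_pos hs, sq_nonneg _, le_rfl, ?_, ?_⟩
  · rw [sub_self, Real.rpow_zero, mul_one, add_zero]
  · intro ρ hρ hρs f F M₀ M₁ hF h0 h1 _ _
    obtain ⟨F₀, hF₀⟩ := exists_isTensorOf (n := 1) (fun _ : Fin 1 => ofRealTest (f 0))
    obtain ⟨F₁, hF₁⟩ := exists_isTensorOf (n := 1) (fun _ : Fin 1 => ofRealTest (f 1))
    have hZ := hall s ρ hs hρ hρs f F F₀ F₁ hF hF₀ hF₁ h0 h1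
    rw [hZ, hκ (f 0) F₀ hF₀, hκ (f 1) F₁ hF₁]
    calc ‖κ * ((∫ x : EuclideanSpace ℝ (Fin 4), f 0 x : ℝ) : ℂ) *
          (κ * ((∫ x : EuclideanSpace ℝ (Fin 4), f 1 x : ℝ) : ℂ))‖
        ≤ ‖κ‖ ^ 2 * (∫ x : EuclideanSpace ℝ (Fin 4), |f 0 x|) * (∫ x : EuclideanSpace ℝ (Fin 4), |f 1 x|) :=
          norm_disconnected_le κ f
      _ = ‖κ‖ ^ 2 * (∫ x : EuclideanSpace ℝ (Fin 4), |f 0 x|) * (∫ x : EuclideanSpace ℝ (Fin 4), |f 1 x|) +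
          0 * ρ ^ 8 * M₀ * M₁ := by ring

end Summit.QuantumFields.YangMills.Theorems.CurvatureKernel

end
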